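import Literature.AnabelianGeometry.SemiGraphs.CoveringGraphHereditary
import Literature.AnabelianGeometry.SemiGraphs.CoveringGraphGaloisCountableFinite
import HarnessLib

/-!
# The hypotheses of [SemiAnbd] Prop 3.6 / Thm 3.7 / Cor 3.9 are hereditary along connected coverings of
# FINITE degree over ANY base satisfying them — no coherence (route T, T7d, finite-degree assembly)

Mochizuki, *Semi-graphs of anabelioids*, Publ. RIMS **42** (2006), §2 Def. 2.3 (iii) p. 25
(quasi-coherent), Rmk. 2.4.1 p. 26, §3 Def. 3.5 (i)–(ii) p. 37 (`G_S → G`, finite objects, tempered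
coverings), Prop. 3.6 p. 38 [cite: MochizukiSemiAnbd2006, Prop 3.6 p.38]; [IUTchI] Rmk. 2.5.3 (i) (T2)
p. 52 [cite: Mochizuki2012, IUTchI Rem. 2.5.3(i)(T2) p.52].

PROOF-ONLY assembly (abc-iut cell, layer L3, route T · T7d, seat abc-iut-L3-t5; no definition).  For a
covering `S` of FINITE degree the two "coherence-hungry" hypotheses transfer with no finite-generation
input: quasi-coherence by `CovObj.isQuasiCoherent_coveringGraph_of_isFinite` (`CoveringGraphHereditary`,
abc-iut-w6-d081: the finitely many pointwise stabilisers over a constituent are intersected) and (T2)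
Galois-countability by `CovObj.isGaloisCountable_coveringGraph_of_isFinite`
(`CoveringGraphGaloisCountableFinite`, this seat: the composite «pre `H'`» is a finite object of
`B^cov(G)`).  Hence:

* `CovObj.prop36Hypotheses_coveringGraph_of_isFinite` / `thm37…` / `cor39…`: for `G` as in Prop. 3.6
  (resp. Thm. 3.7, Cor. 3.9) — quasi-coherent, possibly incoherent and infinite — and `S` a connected
  tempered covering of finite degree, `G_S` satisfies the same hypotheses.

With `CoveringGraphCoherent` (any degree, coherent base) and `CoveringGraphGaloisCountableNegative`
(infinite degree over an incoherent base fails) this completes the heredity table of route T.  Nothing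
here bears on [IUTchIII] Cor. 3.12.
-/

noncomputable section

open CategoryTheory Topology

namespace Literature.AnabelianGeometry.SemiGraphs

open Literature.AlgebraicGeometry.Frobenioids (IsConnectedObj)

universe u

namespace ProfiniteSemiGraph

namespace CovObj

variable {𝒢 : ProfiniteSemiGraph.{u}} (S : CovObj 𝒢)

/-- **The hypotheses of [SemiAnbd] Prop. 3.6 are hereditary along connected tempered coverings of
FINITE degree, over ANY base satisfying them** (quasi-coherent, possibly incoherent and infinite):
connected/countable/injective type/slim (T7a), aloof (T7b), elevated (T7c), quasi-coherent
(abc-iut-w6-d081, finite degree), Galois-countable (finite degree, «pre `H'`»).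
[cite: MochizukiSemiAnbd2006, Prop 3.6 p.38] -/
theorem prop36Hypotheses_coveringGraph_of_isFinite (h36 : 𝒢.Prop36Hypotheses) (hS : S.IsTempered)
    (hSc : IsConnectedObj (⟨S, hS⟩ : BTempCat 𝒢)) (hfin : S.IsFinite) :
    S.coveringGraph.Prop36Hypotheses where
  isConnected := S.isConnected_coveringGraph hS hSc
  isCountable := S.isCountable_coveringGraph h36.isCountable
  isGaloisCountable := S.isGaloisCountable_coveringGraph_of_isFinite h36.isGaloisCountable hfin
  hasVertex := S.hasVertex_coveringGraph_of_isConnectedObj h36.isConnected h36.hasVertex hS hSc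
  isOfInjectiveType := S.isOfInjectiveType_coveringGraph h36.isOfInjectiveType
  isQuasiCoherent := S.isQuasiCoherent_coveringGraph_of_isFinite h36.isConnected h36.isQuasiCoherent hfin
  isTotallyElevated := S.isTotallyElevated_coveringGraph h36.isTotallyElevated hS
  isTotallyAloof := S.isTotallyAloof_coveringGraph h36.isTotallyAloof
  isVerticiallySlim := S.isVerticiallySlim_coveringGraph h36.isVerticiallySlim

/-- **The hypotheses of [SemiAnbd] Thm. 3.7 are hereditary along connected tempered coverings of finite
degree, over any base satisfying them.** [cite: MochizukiSemiAnbd2006, Thm 3.7 p.40] -/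
theorem thm37Hypotheses_coveringGraph_of_isFinite (h37 : 𝒢.Thm37Hypotheses) (hS : S.IsTempered)
    (hSc : IsConnectedObj (⟨S, hS⟩ : BTempCat 𝒢)) (hfin : S.IsFinite) :
    S.coveringGraph.Thm37Hypotheses where
  toProp36Hypotheses := S.prop36Hypotheses_coveringGraph_of_isFinite h37.toProp36Hypotheses hS hSc hfin
  isTotallyEstranged := S.isTotallyEstranged_coveringGraph h37.isTotallyEstranged

/-- **The hypotheses of [SemiAnbd] Cor. 3.9 are hereditary along connected tempered coverings of finite
degree, over any base satisfying them.** [cite: MochizukiSemiAnbd2006, Cor 3.9 p.42] -/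
theorem cor39Hypotheses_coveringGraph_of_isFinite (h39 : Cor39Hypotheses 𝒢) (hS : S.IsTempered)
    (hSc : IsConnectedObj (⟨S, hS⟩ : BTempCat 𝒢)) (hfin : S.IsFinite) :
    Cor39Hypotheses S.coveringGraph where
  toProp36Hypotheses := S.prop36Hypotheses_coveringGraph_of_isFinite h39.toProp36Hypotheses hS hSc hfin
  isTotallyEstranged := S.isTotallyEstranged_coveringGraph h39.isTotallyEstranged
  isGraph := S.isGraph_coveringGraph h39.isGraph

end CovObj

end ProfiniteSemiGraph

end Literature.AnabelianGeometry.SemiGraphs
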